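import Summits.QuantumFields.YangMills.Theorems.UnitScaleTiltProp7TorusGreenGradientBricks
import HarnessLib

/-!
# Route `UnitScaleTilt`, crux K1 «MinimiserStabilityRegPr» (stmt-QuantumFields-19200), route-R E′ path (α′), residue (hK)∕(A3′): THE `d = 3` HESSIAN DECAY OF THE TORUS
# GREEN FUNCTION `|∇ᵢ⁺∇ⱼ⁻G̃_L(z)|·dist(0,z)³ ≤ C`, UNIFORM IN THE PERIOD — the `d = 3` sibling of ✓ `Literature.Probability.LatticeModels.TorusGreenHessianDecay` (`d = 4`) and of
# ✓ `…Prop7TorusGreenGradientDecay.torusGreen_grad_mul_dist_sq_le` (`d = 3` gradient)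

Cell `ym3-torus`, D-0154 (3c) width seat `ym-routeR-w6` (gen 5), on ★routeR-w3 g5's «routeR-w6: GO (G₁-Hess-3)» 2026-08-28T19:13:52Z — the second `G₁`-row that the (A3′)
far field uses for the moment expansion of `Σ_y q_b(y)G̃₁(y − z)` (LOCATE 19200 evidence #53 §10); `--supports stmt-QuantumFields-19200`, count-neutral.  THEOREMS ONLY
(0 `def`, 0 `sorry`).  YM₃ on T³ is a ladder rung (R3), not the Clay problem; nothing here claims the stub, the crux, d = 4 or the gap.

THE POINT.  For the zero-mode-free Green function `G̃_L = torusGreen` of `(ℤ∕Lℤ)³` (✓ `LatticeGreenFunction`), the mixed second differences decay like `dist⁻³` with an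
`L`-independent constant — the lattice, finite-volume form of `∂ᵢ∂ⱼ|x|⁻¹ = O(|x|⁻³)`.  Proof = the tree's heat-kernel template letter for letter: ✓ `torusGreen_hessian_eq`
(`∇∇G̃ = ∫₀^{L²}∇∇[∏_μ q^L_s] ds + tail`), ✓ `hessian_prod_of_ne`∕`hessian_prod_of_eq`, the one-dimensional letters of ✓ `TorusHeatKernel1D` (plain factor `(1∨s)^{−1∕2}`, first
differences `(1∨s)⁻¹`, second difference `(1∨s)^{−3∕2}`, Gaussian weights `(1 + z̃²∕(1∨s))⁻³ ≤ 1`): in `d = 3` both index cases give `(1∨s)^{−5∕2}`, i.e. after keeping the weight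
at the largest coordinate `√(1∨s)·((1∨s) + M²)⁻³`; the half-integer power is removed by AM–GM `2M√T ≤ T + M²`, so that the time integral is ✓ `integral_inv_add_sq_le`
(`∫₀^{L²}((s + M²)²)⁻¹ ≤ M⁻²`) — total `K∕(2M³)`; the Fourier tail is ✓ `abs_torusGreen_hessian_tail_le` (`π²C₀³∕(2L³) ≤ π²C₀³∕(16M³)`, `2M ≤ L`); `dist ≤ 2M`.

WHAT IS PROVED (ns `…Theorems.Prop7TorusGreenHessianDecay`; carrier `TorusSite 3 L = Fin 3 → ZMod L`).
* ★★ `abs_hessian_prod_torusHeatKernel_le_three` — `∃ K > 0, ∀ L s (0 < s ≤ L²) z i j μ₀, |∇ᵢ⁺∇ⱼ⁻[∏_μ q^L_s](z)| ≤ K·√(1∨s)·(((1∨s) + z̃_{μ₀}²)³)⁻¹`.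
* `sqrt_mul_inv_cube_le` — `√T·((T + M²)³)⁻¹ ≤ (2M)⁻¹·((T + M²)²)⁻¹` (`T, M > 0`).
* ★★★ `torusGreen_hessian_mul_dist_cube_le` — `∃ C, ∀ L (i j : Fin 3) (z ≠ 0), |G̃_L(z+eᵢ) − G̃_L(z+eᵢ−eⱼ) − G̃_L(z) + G̃_L(z−eⱼ)|·(Σ_k z̃_k²)^{3∕2} ≤ C`.
HONEST SCOPE.  A Green-function letter on the momentum∕torus carrier of `Literature.Probability.LatticeModels`; the reading on `Site (F.P K) 0` is ✓ `…TorusGreenDictionary`'s (routeR-w3);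
the THIRD differences `|∇³G̃|·dist⁴` (same template, one more `(1∨s)⁻¹`) are not here.

References: G. F. Lawler, V. Limic, *Random Walk: A Modern Introduction*, CUP 2010, Thm 4.3.1, §6.3 [LawlerLimic2010]; T. Bałaban, CMP 96 (1984) 223–250
[Balaban1984PropagatorsII] ((1.9) p.226); CMP 99 (1985) 75–102 [Balaban1985RegularSpaces] ((1.36) p.82).
-/

set_option autoImplicit false

noncomputable section

open MeasureTheory Set Finset ZMod intervalIntegral
open scoped Real BigOperators

namespace Summit.QuantumFields.YangMills.Theorems.Prop7TorusGreenHessianDecay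

open Literature.Probability.LatticeModels
open Summit.QuantumFields.YangMills.Theorems.Prop7TorusGreenGradientBricks (prod_le_apply_of_le_one' integral_inv_add_sq_le)

variable {L : ℕ}

/-! ## §1 The Hessian of the product heat kernel in `d = 3` -/

/-- ★★ **Bound on the HESSIAN of the product heat kernel of `(ℤ/Lℤ)³`**: there is `K > 0` such that for all `L ≥ 1`, `0 < s ≤ L²`, `z ∈ (ℤ/Lℤ)³`, all `i, j` and every
coordinate `μ₀`, `|∇ᵢ⁺∇ⱼ⁻[∏_μ q^L_s(·_μ)](z)| ≤ K·√(1∨s)·(((1∨s) + z̃_{μ₀}²)³)⁻¹`: three one-dimensional factors give `(1∨s)^{−1∕2}` each, the two differences one more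
`(1∨s)^{−1∕2}` each (total `(1∨s)^{−5∕2}`), every factor a Gaussian weight `≤ 1` of which the one at `μ₀` is kept (`(1∨s)^{−5∕2}(1 + z̃²∕(1∨s))⁻³ = √(1∨s)·((1∨s) + z̃²)⁻³`).
[folklore] [cite: LawlerLimic2010, §6.3] -/
theorem abs_hessian_prod_torusHeatKernel_le_three : ∃ K : ℝ, 0 < K ∧ ∀ (L : ℕ) [NeZero L] (s : ℝ),
    0 < s → s ≤ (L : ℝ) ^ 2 → ∀ (z : TorusSite 3 L) (i j μ₀ : Fin 3),
      |(∏ μ, torusHeatKernel s ((z + Pi.single i 1 : TorusSite 3 L) μ)) -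
          (∏ μ, torusHeatKernel s ((z + Pi.single i 1 - Pi.single j 1 : TorusSite 3 L) μ)) -
          (∏ μ, torusHeatKernel s (z μ)) +
          ∏ μ, torusHeatKernel s ((z - Pi.single j 1 : TorusSite 3 L) μ)| ≤
        K * Real.sqrt (max 1 s) * ((max 1 s + ((z μ₀).valMinAbs : ℝ) ^ 2) ^ 3)⁻¹ := by
  obtain ⟨K₀, hK₀, h₀⟩ := abs_torusHeatKernel_le
  obtain ⟨K₁, hK₁, h₁⟩ := abs_torusHeatKernel_fwdDiff_le
  obtain ⟨K₂, hK₂, h₂⟩ := abs_torusHeatKernel_bwdDiff_le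
  obtain ⟨K₃, hK₃, h₃⟩ := abs_torusHeatKernel_sndDiff_le
  set K : ℝ := max (max K₀ K₁) (max K₂ K₃) with hK
  have hK0 : K₀ ≤ K := (le_max_left _ _).trans (le_max_left _ _)
  have hK1 : K₁ ≤ K := (le_max_right _ _).trans (le_max_left _ _)
  have hK2 : K₂ ≤ K := (le_max_left _ _).trans (le_max_right _ _)
  have hK3 : K₃ ≤ K := (le_max_right _ _).trans (le_max_right _ _)
  have hKpos : 0 < K := hK₀.trans_le hK0
  refine ⟨K ^ 3, by positivity, ?_⟩
  intro L _ s hs hsL z i j μ₀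
  set T : ℝ := max 1 s with hT
  have hT1 : 1 ≤ T := le_max_left _ _
  have hT0 : 0 < T := by positivity
  have hsT : s ≤ T := le_max_right _ _
  set σ : ℝ := T ^ (-(1 / 2 : ℝ)) with hσ
  have hσ0 : 0 < σ := Real.rpow_pos_of_pos hT0 _
  have hσσ : σ * σ = T⁻¹ := max_one_rpow_neg_half_mul_self s
  -- `σ·T = √T`
  have hσT : Real.sqrt T = σ * T := by
    rw [Real.sqrt_eq_iff_mul_self_eq_of_pos (by positivity)]
    have hTne : T ≠ 0 := hT0.ne'
    calc σ * T * (σ * T) = (σ * σ) * T * T := by ring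
      _ = T := by rw [hσσ, inv_mul_cancel₀ hTne, one_mul]
  -- the Gaussian weights
  set W : Fin 3 → ℝ := fun μ => ((1 + ((z μ).valMinAbs : ℝ) ^ 2 / T) ^ 3)⁻¹ with hW
  have hW0 : ∀ μ, 0 ≤ W μ := fun μ => by positivity
  have hW1 : ∀ μ, W μ ≤ 1 := fun μ => by
    rw [hW]
    exact inv_le_one_of_one_le₀ (one_le_pow₀ (by
      have : 0 ≤ ((z μ).valMinAbs : ℝ) ^ 2 / T := by positivity
      linarith))
  have hWμ₀ : ∏ μ, W μ ≤ W μ₀ := prod_le_apply_of_le_one' hW0 hW1 μ₀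
  -- the one-dimensional bounds with the common constant `K`
  have b₀ : ∀ m : ZMod L, |torusHeatKernel s m| ≤ K * σ * ((1 + (m.valMinAbs : ℝ) ^ 2 / T) ^ 3)⁻¹ := fun m =>
    (h₀ L s hs hsL m).trans (by gcongr)
  have b₁ : ∀ m : ZMod L, |torusHeatKernel s (m + 1) - torusHeatKernel s m| ≤ K * T⁻¹ * ((1 + (m.valMinAbs : ℝ) ^ 2 / T) ^ 3)⁻¹ := fun m =>
    (h₁ L s hs hsL m).trans (by gcongr)
  have b₂ : ∀ m : ZMod L, |torusHeatKernel s m - torusHeatKernel s (m - 1)| ≤ K * T⁻¹ * ((1 + (m.valMinAbs : ℝ) ^ 2 / T) ^ 3)⁻¹ := fun m =>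
    (h₂ L s hs hsL m).trans (by gcongr)
  have b₃ : ∀ m : ZMod L, |torusHeatKernel s (m + 1) - 2 * torusHeatKernel s m + torusHeatKernel s (m - 1)| ≤
      K * (T⁻¹ * σ) * ((1 + (m.valMinAbs : ℝ) ^ 2 / T) ^ 3)⁻¹ := fun m =>
    (h₃ L s hs hsL m).trans (by gcongr)
  -- the target weight: `K³·T⁻²·σ·W μ₀ = K³·√T·((T + z̃²)³)⁻¹`
  have htarget : K ^ 3 * (T⁻¹ ^ 2 * σ) * W μ₀ = K ^ 3 * Real.sqrt T * ((T + ((z μ₀).valMinAbs : ℝ) ^ 2) ^ 3)⁻¹ := by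
    rw [hW, hσT]
    have hTne : T ≠ 0 := hT0.ne'
    field_simp
  rw [← htarget]
  rcases eq_or_ne i j with rfl | hij
  · -- `i = j`: second difference times two plain factors
    rw [hessian_prod_of_eq (fun m => torusHeatKernel s m) z i, abs_mul, Finset.abs_prod]
    have hcard : ((univ : Finset (Fin 3)).erase i).card = 2 := by
      rw [Finset.card_erase_of_mem (Finset.mem_univ i), Finset.card_univ, Fintype.card_fin]
    have hrest : ∏ μ ∈ (univ : Finset (Fin 3)).erase i, |torusHeatKernel s (z μ)| ≤ ∏ μ ∈ (univ : Finset (Fin 3)).erase i, (K * σ * W μ) :=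
      Finset.prod_le_prod (fun μ _ => abs_nonneg _) fun μ _ => b₀ (z μ)
    calc |torusHeatKernel s (z i + 1) - 2 * torusHeatKernel s (z i) + torusHeatKernel s (z i - 1)| *
          ∏ μ ∈ (univ : Finset (Fin 3)).erase i, |torusHeatKernel s (z μ)|
        ≤ (K * (T⁻¹ * σ) * W i) * ∏ μ ∈ (univ : Finset (Fin 3)).erase i, (K * σ * W μ) :=
          mul_le_mul (b₃ (z i)) hrest (Finset.prod_nonneg fun μ _ => abs_nonneg _) (by positivity)
      _ = K ^ 3 * (T⁻¹ * (σ * σ) * σ) * (W i * ∏ μ ∈ (univ : Finset (Fin 3)).erase i, W μ) := by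
          rw [Finset.prod_mul_distrib, Finset.prod_const, hcard]
          ring
      _ = K ^ 3 * (T⁻¹ ^ 2 * σ) * ∏ μ, W μ := by
          rw [hσσ, Finset.mul_prod_erase _ _ (Finset.mem_univ i)]
          ring
      _ ≤ K ^ 3 * (T⁻¹ ^ 2 * σ) * W μ₀ := by gcongr
  · -- `i ≠ j`: two first differences times one plain factor
    rw [hessian_prod_of_ne (fun m => torusHeatKernel s m) z hij, abs_mul, abs_mul, Finset.abs_prod]
    have hcard : (((univ : Finset (Fin 3)).erase i).erase j).card = 1 := by
      rw [Finset.card_erase_of_mem (Finset.mem_erase.2 ⟨hij.symm, Finset.mem_univ j⟩),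
        Finset.card_erase_of_mem (Finset.mem_univ i), Finset.card_univ, Fintype.card_fin]
    have hrest : ∏ μ ∈ ((univ : Finset (Fin 3)).erase i).erase j, |torusHeatKernel s (z μ)| ≤
        ∏ μ ∈ ((univ : Finset (Fin 3)).erase i).erase j, (K * σ * W μ) :=
      Finset.prod_le_prod (fun μ _ => abs_nonneg _) fun μ _ => b₀ (z μ)
    have hsplit : ∏ μ, W μ = W i * W j * ∏ μ ∈ ((univ : Finset (Fin 3)).erase i).erase j, W μ := by
      rw [mul_assoc, Finset.mul_prod_erase _ _ (Finset.mem_erase.2 ⟨hij.symm, Finset.mem_univ j⟩),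
        Finset.mul_prod_erase _ _ (Finset.mem_univ i)]
    calc |torusHeatKernel s (z i + 1) - torusHeatKernel s (z i)| * |torusHeatKernel s (z j) - torusHeatKernel s (z j - 1)| *
          ∏ μ ∈ ((univ : Finset (Fin 3)).erase i).erase j, |torusHeatKernel s (z μ)|
        ≤ (K * T⁻¹ * W i) * (K * T⁻¹ * W j) * ∏ μ ∈ ((univ : Finset (Fin 3)).erase i).erase j, (K * σ * W μ) :=
          mul_le_mul (mul_le_mul (b₁ (z i)) (b₂ (z j)) (abs_nonneg _) (by positivity)) hrest
            (Finset.prod_nonneg fun μ _ => abs_nonneg _) (by positivity)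
      _ = K ^ 3 * (T⁻¹ * T⁻¹ * σ) * (W i * W j * ∏ μ ∈ ((univ : Finset (Fin 3)).erase i).erase j, W μ) := by
          rw [Finset.prod_mul_distrib, Finset.prod_const, hcard]
          ring
      _ = K ^ 3 * (T⁻¹ ^ 2 * σ) * ∏ μ, W μ := by rw [← hsplit]; ring
      _ ≤ K ^ 3 * (T⁻¹ ^ 2 * σ) * W μ₀ := by gcongr

/-! ## §2 The time integral without half-integer powers -/

/-- **AM–GM for the `d = 3` kernel bound**: `√T·((T + M²)³)⁻¹ ≤ (2M)⁻¹·((T + M²)²)⁻¹` for `T, M > 0` (`2M√T ≤ T + M²`). [folklore] -/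
theorem sqrt_mul_inv_cube_le {T M : ℝ} (hT : 0 < T) (hM : 0 < M) :
    Real.sqrt T * ((T + M ^ 2) ^ 3)⁻¹ ≤ (2 * M)⁻¹ * ((T + M ^ 2) ^ 2)⁻¹ := by
  have hS := Real.sq_sqrt hT.le
  have hS0 := Real.sqrt_nonneg T
  have hamgm : 2 * M * Real.sqrt T ≤ T + M ^ 2 := by nlinarith [sq_nonneg (Real.sqrt T - M)]
  have hTM : 0 < T + M ^ 2 := by positivity
  rw [show Real.sqrt T * ((T + M ^ 2) ^ 3)⁻¹ = (2 * M * Real.sqrt T) * ((2 * M)⁻¹ * ((T + M ^ 2) ^ 3)⁻¹) by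
    field_simp]
  calc 2 * M * Real.sqrt T * ((2 * M)⁻¹ * ((T + M ^ 2) ^ 3)⁻¹)
      ≤ (T + M ^ 2) * ((2 * M)⁻¹ * ((T + M ^ 2) ^ 3)⁻¹) := mul_le_mul_of_nonneg_right hamgm (by positivity)
    _ = (2 * M)⁻¹ * ((T + M ^ 2) ^ 2)⁻¹ := by field_simp

/-! ## §3 ★★★ The Hessian decay in `d = 3` -/

/-- ★★★ **DECAY OF THE HESSIAN OF THE TORUS GREEN FUNCTION IN `d = 3`, UNIFORMLY IN THE PERIOD.**  There is an absolute constant `C` such that for every `L ≥ 1`,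
all `i, j ∈ {0,1,2}` and every `z ≠ 0` in `(ℤ/Lℤ)³`:  `|G̃_L(z+eᵢ) − G̃_L(z+eᵢ−eⱼ) − G̃_L(z) + G̃_L(z−eⱼ)|·(Σ_μ z̃_μ²)^{3∕2} ≤ C`  (`G̃_L = torusGreen`, `z̃_μ = valMinAbs (z μ)`):
the lattice, finite-volume form of `∂ᵢ∂ⱼ|x|⁻¹ = O(|x|⁻³)` (Lawler–Limic 2010 Thm 4.3.1∕§6.3 on `ℤ³`); at `dist ≍ L` it is the size `O(L⁻³)` of the Hessian of the quadratic
background of the removed zero mode.  Heat-kernel part `≤ K∕(2M)·∫₀^{L²}((s+M²)²)⁻¹ds ≤ K∕(2M³)` (`M = max_μ|z̃_μ| ≥ 1`), Fourier tail `≤ (π²∕2)C₀³L⁻³ ≤ (π²∕16)C₀³M⁻³`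
(`2M ≤ L`), and `√(Σ_μz̃_μ²) ≤ 2M`. [folklore] [cite: LawlerLimic2010, Thm 4.3.1] -/
theorem torusGreen_hessian_mul_dist_cube_le : ∃ C : ℝ, ∀ (L : ℕ) [NeZero L] (i j : Fin 3) (z : TorusSite 3 L), z ≠ 0 →
    |torusGreen (z + Pi.single i 1) - torusGreen (z + Pi.single i 1 - Pi.single j 1) - torusGreen z + torusGreen (z - Pi.single j 1)| *
      Real.sqrt (∑ k, (((z k).valMinAbs : ℤ) : ℝ) ^ 2) ^ 3 ≤ C := by
  obtain ⟨K, hK, hP⟩ := abs_hessian_prod_torusHeatKernel_le_three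
  set C₀ : ℝ := ∑' n : ℤ, (1 / 2 : ℝ) ^ n.natAbs with hC₀
  refine ⟨4 * K + π ^ 2 / 2 * C₀ ^ 3, ?_⟩
  intro L _ i j z hz
  have hL : (0 : ℝ) < L := by exact_mod_cast Nat.pos_of_ne_zero (NeZero.ne L)
  -- the largest centred coordinate
  obtain ⟨μ₀, -, hμ₀⟩ := Finset.exists_max_image (univ : Finset (Fin 3)) (fun μ => (z μ).valMinAbs.natAbs) Finset.univ_nonempty
  set M : ℝ := |((z μ₀).valMinAbs : ℝ)| with hM
  have hMμ : ∀ μ, |((z μ).valMinAbs : ℝ)| ≤ M := fun μ => by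
    have h := hμ₀ μ (Finset.mem_univ μ)
    rw [hM, ← Int.cast_abs, ← Int.cast_abs, ← Int.natCast_natAbs, ← Int.natCast_natAbs]
    exact_mod_cast h
  have hM1 : 1 ≤ M := by
    obtain ⟨μ₁, hμ₁⟩ : ∃ μ, z μ ≠ 0 := by
      by_contra h
      push Not at h
      exact hz (funext h)
    have h1 : (z μ₁).valMinAbs ≠ 0 := fun h => hμ₁ ((ZMod.valMinAbs_eq_zero _).1 h)
    have h2 : (1 : ℝ) ≤ |((z μ₁).valMinAbs : ℝ)| := by
      rw [← Int.cast_abs]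
      exact_mod_cast Int.one_le_abs h1
    exact h2.trans (hMμ μ₁)
  have hM0 : 0 < M := by linarith
  have hML : 2 * M ≤ L := by
    have h := two_mul_abs_valMinAbs_le (z μ₀)
    rw [hM, ← Int.cast_abs]
    exact_mod_cast h
  -- the distance: `√(Σ z̃²)³ ≤ 8M³`
  have hdist0 : 0 ≤ ∑ k, (((z k).valMinAbs : ℤ) : ℝ) ^ 2 := Finset.sum_nonneg fun k _ => sq_nonneg _
  have hdist : Real.sqrt (∑ k, (((z k).valMinAbs : ℤ) : ℝ) ^ 2) ^ 3 ≤ 8 * M ^ 3 := by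
    have hsum : ∑ k, (((z k).valMinAbs : ℤ) : ℝ) ^ 2 ≤ (2 * M) ^ 2 := by
      calc ∑ k, (((z k).valMinAbs : ℤ) : ℝ) ^ 2 ≤ ∑ _k : Fin 3, M ^ 2 :=
            Finset.sum_le_sum fun k _ => by
              rw [← sq_abs]
              exact pow_le_pow_left₀ (abs_nonneg _) (hMμ k) 2
        _ = 3 * M ^ 2 := by simp
        _ ≤ (2 * M) ^ 2 := by nlinarith
    have hsq : Real.sqrt (∑ k, (((z k).valMinAbs : ℤ) : ℝ) ^ 2) ≤ 2 * M := by
      rw [Real.sqrt_le_left (by positivity)]; exact hsum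
    calc Real.sqrt (∑ k, (((z k).valMinAbs : ℤ) : ℝ) ^ 2) ^ 3 ≤ (2 * M) ^ 3 := pow_le_pow_left₀ (Real.sqrt_nonneg _) hsq 3
      _ = 8 * M ^ 3 := by ring
  -- heat-kernel part and tail at `S = L²`
  have hS : (0 : ℝ) ≤ (L : ℝ) ^ 2 := by positivity
  rw [torusGreen_hessian_eq z i j ((L : ℝ) ^ 2)]
  have hmain : |∫ s in (0 : ℝ)..(L : ℝ) ^ 2,
      ((∏ μ, torusHeatKernel s ((z + Pi.single i 1 : TorusSite 3 L) μ)) -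
        (∏ μ, torusHeatKernel s ((z + Pi.single i 1 - Pi.single j 1 : TorusSite 3 L) μ)) -
        (∏ μ, torusHeatKernel s (z μ)) +
        ∏ μ, torusHeatKernel s ((z - Pi.single j 1 : TorusSite 3 L) μ))| ≤ K * (2 * M)⁻¹ * (M ^ 2)⁻¹ := by
    have hb : ∀ s ∈ Set.Ioc (0 : ℝ) ((L : ℝ) ^ 2),
        |(∏ μ, torusHeatKernel s ((z + Pi.single i 1 : TorusSite 3 L) μ)) -
          (∏ μ, torusHeatKernel s ((z + Pi.single i 1 - Pi.single j 1 : TorusSite 3 L) μ)) -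
          (∏ μ, torusHeatKernel s (z μ)) +
          ∏ μ, torusHeatKernel s ((z - Pi.single j 1 : TorusSite 3 L) μ)| ≤ K * (2 * M)⁻¹ * ((s + M ^ 2) ^ 2)⁻¹ := by
      intro s hs
      refine (hP L s hs.1 hs.2 z i j μ₀).trans ?_
      rw [hM, sq_abs]
      set T : ℝ := max 1 s with hT
      set c : ℝ := ((z μ₀).valMinAbs : ℝ) ^ 2 with hc
      have hcM : c = M ^ 2 := by rw [hc, hM, sq_abs]
      have hTs : s ≤ T := le_max_right _ _
      have hT0 : 0 < T := lt_of_lt_of_le hs.1 hTs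
      have hsc : 0 < s + M ^ 2 := by have := hs.1; positivity
      rw [hcM]
      have h1 : Real.sqrt T * ((T + M ^ 2) ^ 3)⁻¹ ≤ (2 * M)⁻¹ * ((T + M ^ 2) ^ 2)⁻¹ := sqrt_mul_inv_cube_le hT0 hM0
      have h2 : ((T + M ^ 2) ^ 2)⁻¹ ≤ ((s + M ^ 2) ^ 2)⁻¹ := by
        apply inv_anti₀ (by positivity)
        exact pow_le_pow_left₀ hsc.le (by linarith) 2
      calc K * Real.sqrt T * ((T + M ^ 2) ^ 3)⁻¹ = K * (Real.sqrt T * ((T + M ^ 2) ^ 3)⁻¹) := by ring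
        _ ≤ K * ((2 * M)⁻¹ * ((s + M ^ 2) ^ 2)⁻¹) :=
            mul_le_mul_of_nonneg_left (h1.trans (mul_le_mul_of_nonneg_left h2 (by positivity))) hK.le
        _ = K * (2 * M)⁻¹ * ((s + M ^ 2) ^ 2)⁻¹ := by ring
    have hcont : IntervalIntegrable (fun s : ℝ => K * (2 * M)⁻¹ * ((s + M ^ 2) ^ 2)⁻¹) volume 0 ((L : ℝ) ^ 2) := by
      refine ContinuousOn.intervalIntegrable ?_
      rw [Set.uIcc_of_le hS]
      refine continuousOn_const.mul (ContinuousOn.inv₀ ((continuousOn_id.add continuousOn_const).pow 2) fun s hs => ?_)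
      have : 0 < s + M ^ 2 := by have := hs.1; positivity
      positivity
    calc _ ≤ ∫ s in (0 : ℝ)..(L : ℝ) ^ 2, K * (2 * M)⁻¹ * ((s + M ^ 2) ^ 2)⁻¹ := by
          have h := intervalIntegral.norm_integral_le_of_norm_le hS
            (Filter.Eventually.of_forall fun s hs => (Real.norm_eq_abs _).le.trans (hb s hs)) hcont
          rwa [Real.norm_eq_abs] at h
      _ = K * (2 * M)⁻¹ * ∫ s in (0 : ℝ)..(L : ℝ) ^ 2, ((s + M ^ 2) ^ 2)⁻¹ := intervalIntegral.integral_const_mul _ _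
      _ ≤ K * (2 * M)⁻¹ * (M ^ 2)⁻¹ := by
          gcongr
          exact integral_inv_add_sq_le (by positivity) hS
  have htail := abs_torusGreen_hessian_tail_le z i j
  rw [← hC₀] at htail
  -- `1/L³ ≤ 1/(8M³)`
  have hL3 : ((L : ℝ) ^ 3)⁻¹ ≤ (8 * M ^ 3)⁻¹ := by
    apply inv_anti₀ (by positivity)
    have : (2 * M) ^ 3 ≤ (L : ℝ) ^ 3 := pow_le_pow_left₀ (by positivity) hML 3
    nlinarith
  calc _ ≤ (K * (2 * M)⁻¹ * (M ^ 2)⁻¹ + π ^ 2 / 2 * C₀ ^ 3 / (L : ℝ) ^ 3) * (8 * M ^ 3) :=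
        mul_le_mul ((abs_add_le _ _).trans (add_le_add hmain htail)) hdist (by positivity) (by positivity)
    _ ≤ (K * (2 * M)⁻¹ * (M ^ 2)⁻¹ + π ^ 2 / 2 * C₀ ^ 3 * (8 * M ^ 3)⁻¹) * (8 * M ^ 3) := by
        gcongr
        rw [div_eq_mul_inv]
        gcongr
    _ = 4 * K + π ^ 2 / 2 * C₀ ^ 3 := by
        field_simp
        ring

end Summit.QuantumFields.YangMills.Theorems.Prop7TorusGreenHessianDecay

end
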